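import Mathlib
import HarnessLib

/-!
# Vertical convexity: the 1-D core of the semi-elliptic (TH) Liouville theorem

Seat ns-poloidal-K2-p2 g6 (interim lead-of-record on crux K2 `PoloidalWindowRigidity` = stmt-NavierStokesRegularity-19708;
line `mixed_type` v1, stubs `stub_semiElliptic` / `stub_hyperbolicTH`; item stmt-20428 `LrcModEntire`, stub `stub_twistingTH`).
Memo TH-ELLIPTIC-LIOUVILLE-g6 (evidence on 19708/20428) proves on paper:

> **Theorem A.** A bounded `w ∈ C²(ℝ² × ℝ)` with bounded first and second derivatives solving the (TH) slice equation
> `w_zz + Λ(z) Δₕ w = 0` with `Λ ≥ 0` (no upper bound, no positive lower bound, poles at flat heights allowed) and `Λ > 0`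
> at one height is CONSTANT.

Consequence for the crux: a (TH) class profile whose shear slope is `≥ 0` at every height of ONE slice does not exist, so
`stub_semiElliptic` holds on its (TH) part and `stub_twistingTH` may assume a hyperbolic window.  The proof cuts `w` to a
horizontal frequency annulus (`u = w ∗ₕ φ`), where a weighted reverse Bernstein inequality `∫|u|²ρ ≤ C∫|∇ₕu|²ρ` holds, and
shows that `q(z) = ∫|u(·,z)|²ρ` is CONVEX and bounded, hence `0`.  This file is the ABSTRACT 1-D CORE of that argument,
isolated from all Fourier analysis and from the weight: over an arbitrary finite measure space (the weighted plane), for a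
family `u(z,·)` with `u_zz = −Λ(z)·lap` off an exceptional nowhere-dense set of heights, an «integration-by-parts inequality»
`∫u·lap ≤ −∫g² + δ∫|u||g|` (on `ℝ²`: `g = |∇ₕu|`, `δ = 2/σ` from `|∇ρ_σ| ≤ (2/σ)ρ_σ`) and a «reverse inequality»
`∫u² ≤ C∫g²`, with `0 ≤ δ`, `δ(C+1) ≤ 1`, force `∫u(z,·)² = 0` for every `z` as soon as `Λ ≥ 0` everywhere and `Λ > 0` at one
non-exceptional height.

* `integrable_of_abs_le`, `hasDerivAt_integral_of_bdd` — bounded measurable data on a finite measure space are integrable, and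
  `z ↦ ∫F(z,·)` is differentiated under the integral (dominated differentiation with a constant bound);
* `deriv_eq_zero_of_monotone_deriv_of_abs_le` — `q` differentiable with MONOTONE derivative and `q` bounded ⇒ `deriv q ≡ 0`;
* `integral_sq_eq_zero_of_verticalConvexity` — **the core**: the conclusion `∫u(z,·)² = 0` for all `z`.

The remaining files of the port (weight `ρ_σ` and the IBP inequality on `ℝ²`; Schwartz-kernel frequency cut-off and the
reverse inequality; assembly `w ∗ β_ε = w ∗ β_N ⇒ ∇ₕw = 0`; class corollary) are sized in the memo §3 and left to the next
generation of this seat.  WHAT THIS IS NOT: not a claim about Navier–Stokes and not a stub — a generic real-analysis lemma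
(bears_on LADDER-NS N0 via crux K2 = stmt-19708 / item 20428).
-/

-- the summit and its single sub-problem share the name (CONVENTIONS §1)
set_option linter.dupNamespace false

namespace Summit.NavierStokesRegularity.NavierStokesRegularity.Theorems.PoloidalWindowDoorPoloidalWindowRigidityVerticalConvexity

open Set Function Filter Topology MeasureTheory

/-! ### One-variable lemma: bounded with monotone derivative ⇒ derivative vanishes -/

/-- A differentiable `q : ℝ → ℝ` whose derivative is MONOTONE and which is bounded (`|q| ≤ B`) has identically vanishing
derivative: if `q′(z₀) > 0` then `q(y) ≥ q(z₀) + q′(z₀)(y − z₀) → +∞`, if `q′(z₀) < 0` then `q(x) → +∞` as `x → −∞`. [folklore] -/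
theorem deriv_eq_zero_of_monotone_deriv_of_abs_le {q : ℝ → ℝ} (hq : Differentiable ℝ q)
    (hmono : Monotone (deriv q)) {B : ℝ} (hB : ∀ z, |q z| ≤ B) (z₀ : ℝ) : deriv q z₀ = 0 := by
  by_contra hne
  rcases lt_or_gt_of_ne hne with hneg | hpos
  · -- `q′(z₀) < 0`: on `(-∞, z₀]` the derivative is `≤ q′(z₀)`, so `q x ≥ q z₀ + |q′ z₀| (z₀ - x)`
    set c := deriv q z₀ with hc
    have hD : Convex ℝ (Iic z₀) := convex_Iic z₀
    have hle : ∀ x ∈ interior (Iic z₀), deriv q x ≤ c := by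
      intro x hx
      rw [interior_Iic] at hx
      exact hmono (le_of_lt hx)
    -- choose `x` far to the left
    set x : ℝ := z₀ - (2 * B + 1) / (-c) with hx
    have hcpos : 0 < -c := by linarith
    have hxle : x ≤ z₀ := by
      have : 0 ≤ (2 * B + 1) / (-c) := by
        apply div_nonneg _ hcpos.le
        linarith [abs_nonneg (q z₀), hB z₀]
      linarith
    have key := hD.image_sub_le_mul_sub_of_deriv_le hq.continuous.continuousOn
      (hq.differentiableOn) hle x (by exact hxle) z₀ (le_refl z₀) hxle
    -- `q z₀ - q x ≤ c * (z₀ - x) = -(2B+1)`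
    have hcx : c * (z₀ - x) = -(2 * B + 1) := by
      rw [hx]
      field_simp
      ring
    have h1 := hB x
    have h2 := hB z₀
    rw [abs_le] at h1 h2
    linarith
  · -- `q′(z₀) > 0`: on `[z₀, ∞)` the derivative is `≥ q′(z₀)`, so `q y ≥ q z₀ + q′ z₀ (y - z₀)`
    set c := deriv q z₀ with hc
    have hD : Convex ℝ (Ici z₀) := convex_Ici z₀
    have hge : ∀ x ∈ interior (Ici z₀), c ≤ deriv q x := by
      intro x hx
      rw [interior_Ici] at hx
      exact hmono (le_of_lt hx)
    set y : ℝ := z₀ + (2 * B + 1) / c with hy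
    have hyge : z₀ ≤ y := by
      have : 0 ≤ (2 * B + 1) / c := by
        apply div_nonneg _ hpos.le
        linarith [abs_nonneg (q z₀), hB z₀]
      linarith
    have key := hD.mul_sub_le_image_sub_of_le_deriv hq.continuous.continuousOn
      (hq.differentiableOn) hge z₀ (le_refl z₀) y hyge hyge
    have hcy : c * (y - z₀) = 2 * B + 1 := by
      rw [hy]
      field_simp
      ring
    have h1 := hB y
    have h2 := hB z₀
    rw [abs_le] at h1 h2
    linarith

/-! ### Parametric integrals of bounded data on a finite measure space -/

section Param

variable {α : Type*} [MeasurableSpace α] {μ : Measure α} [IsFiniteMeasure μ]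

/-- A pointwise-bounded a.e.-strongly-measurable function on a finite measure space is integrable. [folklore] -/
theorem integrable_of_abs_le {f : α → ℝ} (hf : AEStronglyMeasurable f μ) {M : ℝ} (hM : ∀ a, |f a| ≤ M) :
    Integrable f μ :=
  (integrable_const M).mono' hf (Eventually.of_forall fun a => by
    rw [Real.norm_eq_abs]; exact hM a)

/-- **Derivative of `z ↦ ∫ F(z,·)` under the integral** for data differentiable in `z` at every point with a pointwise-bounded
`z`-derivative, on a finite measure space (dominated differentiation with a constant bound). [folklore] -/
theorem hasDerivAt_integral_of_bdd (F F' : ℝ → α → ℝ) (hFm : ∀ z, AEStronglyMeasurable (F z) μ)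
    (hF'm : ∀ z, AEStronglyMeasurable (F' z) μ) {M M' : ℝ} (hM : ∀ z a, |F z a| ≤ M)
    (hM' : ∀ z a, |F' z a| ≤ M') (hd : ∀ a z, HasDerivAt (fun s => F s a) (F' z a) z) (z₀ : ℝ) :
    HasDerivAt (fun z => ∫ a, F z a ∂μ) (∫ a, F' z₀ a ∂μ) z₀ := by
  have h := hasDerivAt_integral_of_dominated_loc_of_deriv_le (μ := μ) (F := F) (F' := F') (x₀ := z₀)
    (s := univ) (bound := fun _ => M') univ_mem (Eventually.of_forall hFm)
    (integrable_of_abs_le (hFm z₀) (hM z₀)) (hF'm z₀)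
    (Eventually.of_forall fun a z _ => by rw [Real.norm_eq_abs]; exact hM' z a)
    (integrable_const M') (Eventually.of_forall fun a z _ => hd a z)
  exact h.2

end Param

/-! ### The core -/

section Core

variable {α : Type*} [MeasurableSpace α] {μ : Measure α} [IsFiniteMeasure μ]

/-- **VERTICAL CONVEXITY ⇒ VANISHING (the 1-D core of the semi-elliptic (TH) Liouville theorem).**
Over a finite measure space `(α, μ)` (in the application: the horizontal plane with the weight `ρ_σ dx`) let
`u, u_z, u_zz, lap, g : ℝ → α → ℝ` be pointwise bounded and measurable in `a`, with `u_z = ∂_z u`, `u_zz = ∂_z u_z` pointwise and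
`u_zz(·,a)` continuous, and suppose
* (equation) `u_zz(z,a) = −Λ(z)·lap(z,a)` for every height `z` off an exceptional set `F` with dense complement, with `Λ ≥ 0`
  everywhere and `Λ(z₁) > 0` at some `z₁ ∉ F`;
* (integration by parts, with the weight's error) `∫ u·lap ≤ −∫ g² + δ ∫ |u|·|g|` at every height;
* (reverse inequality — the frequency cut-off) `∫ u² ≤ C ∫ g²` at every height;
* `0 ≤ δ`, `δ(C+1) ≤ 1` (no sign on `C` is needed).
Then `∫ u(z,·)² dμ = 0` for EVERY `z`.  Proof: `q(z) = ∫u²` has `q″ = 2∫u_z² + 2∫u·u_zz ≥ 2∫u_z² + Λ∫g² ≥ 0` off `F`, hence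
everywhere by continuity; `q` is bounded, so `q′ ≡ 0` (previous lemma), so `q″ ≡ 0`, so `∫g(z₁,·)² = 0`, so `q(z₁) = 0`, so
`q ≡ 0`. [folklore] -/
theorem integral_sq_eq_zero_of_verticalConvexity (u uz uzz lap g : ℝ → α → ℝ) (Λ : ℝ → ℝ) (F : Set ℝ)
    {C δ M : ℝ} {z₁ : ℝ}
    (hum : ∀ z, AEStronglyMeasurable (u z) μ) (huzm : ∀ z, AEStronglyMeasurable (uz z) μ)
    (huzzm : ∀ z, AEStronglyMeasurable (uzz z) μ) (hlapm : ∀ z, AEStronglyMeasurable (lap z) μ)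
    (hgm : ∀ z, AEStronglyMeasurable (g z) μ)
    (hbu : ∀ z a, |u z a| ≤ M) (hbuz : ∀ z a, |uz z a| ≤ M) (hbuzz : ∀ z a, |uzz z a| ≤ M)
    (hblap : ∀ z a, |lap z a| ≤ M) (hbg : ∀ z a, |g z a| ≤ M)
    (hd1 : ∀ a z, HasDerivAt (fun s => u s a) (uz z a) z) (hd2 : ∀ a z, HasDerivAt (fun s => uz s a) (uzz z a) z)
    (hczz : ∀ a, Continuous fun z => uzz z a)
    (hF : Dense Fᶜ) (hΛ : ∀ z, 0 ≤ Λ z) (hz₁ : z₁ ∉ F) (hΛ₁ : 0 < Λ z₁)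
    (heq : ∀ z, z ∉ F → ∀ a, uzz z a = -(Λ z) * lap z a)
    (hibp : ∀ z, ∫ a, u z a * lap z a ∂μ ≤ -(∫ a, g z a ^ 2 ∂μ) + δ * ∫ a, |u z a| * |g z a| ∂μ)
    (hrev : ∀ z, ∫ a, u z a ^ 2 ∂μ ≤ C * ∫ a, g z a ^ 2 ∂μ)
    (hδ : 0 ≤ δ) (hδC : δ * (C + 1) ≤ 1) :
    ∀ z, ∫ a, u z a ^ 2 ∂μ = 0 := by
  classical
  -- nonnegativity of `M` (the space may be empty; handle via a by_cases on `Nonempty α`)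
  -- the three integral functions
  set q : ℝ → ℝ := fun z => ∫ a, u z a ^ 2 ∂μ with hq
  set q' : ℝ → ℝ := fun z => ∫ a, 2 * (u z a * uz z a) ∂μ with hq'
  set q'' : ℝ → ℝ := fun z => ∫ a, 2 * (uz z a ^ 2 + u z a * uzz z a) ∂μ with hq''
  set G : ℝ → ℝ := fun z => ∫ a, g z a ^ 2 ∂μ with hG
  have hM : ∀ z a, 0 ≤ M := fun z a => (abs_nonneg _).trans (hbu z a)
  -- measurability / boundedness of the integrands
  have m_sq : ∀ z, AEStronglyMeasurable (fun a => u z a ^ 2) μ := fun z => (hum z).pow 2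
  have m_q' : ∀ z, AEStronglyMeasurable (fun a => 2 * (u z a * uz z a)) μ := fun z =>
    ((hum z).mul (huzm z)).const_mul 2
  have m_q'' : ∀ z, AEStronglyMeasurable (fun a => 2 * (uz z a ^ 2 + u z a * uzz z a)) μ := fun z =>
    (((huzm z).pow 2).add ((hum z).mul (huzzm z))).const_mul 2
  have b_sq : ∀ z a, |u z a ^ 2| ≤ M ^ 2 := fun z a => by
    rw [abs_pow]; exact pow_le_pow_left₀ (abs_nonneg _) (hbu z a) 2
  have m_g2 : ∀ z, AEStronglyMeasurable (fun a => g z a ^ 2) μ := fun z => (hgm z).pow 2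
  have b_g2 : ∀ z a, |g z a ^ 2| ≤ M ^ 2 := fun z a => by
    rw [abs_pow]; exact pow_le_pow_left₀ (abs_nonneg _) (hbg z a) 2
  have i_g2 : ∀ z, Integrable (fun a => g z a ^ 2) μ := fun z => integrable_of_abs_le (m_g2 z) (b_g2 z)
  have b_q' : ∀ z a, |2 * (u z a * uz z a)| ≤ 2 * (M * M) := fun z a => by
    rw [abs_mul, abs_mul, abs_two]
    exact mul_le_mul_of_nonneg_left (mul_le_mul (hbu z a) (hbuz z a) (abs_nonneg _) (hM z a)) (by norm_num)
  have b_q'' : ∀ z a, |2 * (uz z a ^ 2 + u z a * uzz z a)| ≤ 2 * (M ^ 2 + M * M) := fun z a => by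
    rw [abs_mul, abs_two]
    refine mul_le_mul_of_nonneg_left ((abs_add_le _ _).trans (add_le_add ?_ ?_)) (by norm_num)
    · rw [abs_pow]; exact pow_le_pow_left₀ (abs_nonneg _) (hbuz z a) 2
    · rw [abs_mul]; exact mul_le_mul (hbu z a) (hbuzz z a) (abs_nonneg _) (hM z a)
  -- `q' = deriv q`, `q'' = deriv q'`
  have hdq : ∀ z, HasDerivAt q (q' z) z := by
    intro z
    have h := hasDerivAt_integral_of_bdd (μ := μ) (fun z a => u z a ^ 2) (fun z a => 2 * (u z a * uz z a))
      m_sq m_q' b_sq b_q' (fun a z => by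
        show HasDerivAt (fun s => u s a ^ 2) (2 * (u z a * uz z a)) z
        have h2 : HasDerivAt (fun s => u s a * u s a) (uz z a * u z a + u z a * uz z a) z :=
          (hd1 a z).mul (hd1 a z)
        have e : (fun s => u s a ^ 2) = fun s => u s a * u s a := funext fun s => sq _
        rw [e]
        exact h2.congr_deriv (by ring)) z
    exact h
  have hdq' : ∀ z, HasDerivAt q' (q'' z) z := by
    intro z
    have h := hasDerivAt_integral_of_bdd (μ := μ) (fun z a => 2 * (u z a * uz z a))
      (fun z a => 2 * (uz z a ^ 2 + u z a * uzz z a)) m_q' m_q'' b_q' b_q'' (fun a z => by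
        have := ((hd1 a z).mul (hd2 a z)).const_mul 2
        simpa [sq, mul_comm, add_comm] using this) z
    exact h
  have hq_diff : Differentiable ℝ q := fun z => (hdq z).differentiableAt
  have hq'_diff : Differentiable ℝ q' := fun z => (hdq' z).differentiableAt
  have hderiv_q : deriv q = q' := funext fun z => (hdq z).deriv
  have hderiv_q' : deriv q' = q'' := funext fun z => (hdq' z).deriv
  -- the key lower bound `q'' z ≥ Λ z * G z` off `F`
  have hGnn : ∀ z, 0 ≤ G z := fun z => integral_nonneg fun a => sq_nonneg _
  have hint_ug : ∀ z, ∫ a, |u z a| * |g z a| ∂μ ≤ (1 / 2) * (C + 1) * G z := by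
    intro z
    have h1 : ∫ a, |u z a| * |g z a| ∂μ ≤ ∫ a, ((1 : ℝ) / 2) * (u z a ^ 2 + g z a ^ 2) ∂μ := by
      apply integral_mono_of_nonneg
      · exact Eventually.of_forall fun a => mul_nonneg (abs_nonneg _) (abs_nonneg _)
      · exact ((integrable_of_abs_le (m_sq z) (b_sq z)).add (i_g2 z)).const_mul _
      · exact Eventually.of_forall fun a => by
          have := two_mul_le_add_sq (|u z a|) (|g z a|)
          rw [sq_abs, sq_abs] at this
          linarith
    have h2 : ∫ a, ((1 : ℝ) / 2) * (u z a ^ 2 + g z a ^ 2) ∂μ = (1 / 2) * (q z + G z) := by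
      rw [integral_const_mul, integral_add (integrable_of_abs_le (m_sq z) (b_sq z)) (i_g2 z)]
    rw [h2] at h1
    have h3 : q z ≤ C * G z := hrev z
    nlinarith [hGnn z]
  have hkey : ∀ z, z ∉ F → Λ z * G z ≤ q'' z := by
    intro z hz
    -- `q'' z = 2 ∫ uz² + 2 ∫ u uzz` and `∫ u uzz = -Λ ∫ u lap`
    have i_uz2 : Integrable (fun a => uz z a ^ 2) μ := integrable_of_abs_le ((huzm z).pow 2) (fun a => by
      rw [abs_pow]; exact pow_le_pow_left₀ (abs_nonneg _) (hbuz z a) 2)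
    have i_uuzz : Integrable (fun a => u z a * uzz z a) μ := integrable_of_abs_le ((hum z).mul (huzzm z))
      (fun a => by rw [abs_mul]; exact mul_le_mul (hbu z a) (hbuzz z a) (abs_nonneg _) (hM z a))
    have i_ulap : Integrable (fun a => u z a * lap z a) μ := integrable_of_abs_le ((hum z).mul (hlapm z))
      (fun a => by rw [abs_mul]; exact mul_le_mul (hbu z a) (hblap z a) (abs_nonneg _) (hM z a))
    have e1 : q'' z = 2 * (∫ a, uz z a ^ 2 ∂μ) + 2 * ∫ a, u z a * uzz z a ∂μ := by
      simp only [hq'']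
      rw [integral_const_mul, integral_add i_uz2 i_uuzz]
      ring
    have e2 : ∫ a, u z a * uzz z a ∂μ = -(Λ z) * ∫ a, u z a * lap z a ∂μ := by
      rw [← integral_const_mul]
      refine integral_congr_ae (Eventually.of_forall fun a => ?_)
      simp only [heq z hz a]
      ring
    have e3 : 0 ≤ ∫ a, uz z a ^ 2 ∂μ := integral_nonneg fun a => sq_nonneg _
    rw [e1, e2]
    have h4 := hibp z
    have h5 := hint_ug z
    have hΛz := hΛ z
    -- `-Λ ∫ u lap ≥ Λ (G - δ ∫|u||g|) ≥ Λ (G - δ (C+1)/2 G) ≥ Λ G / 2`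
    have h6 : -(Λ z) * ∫ a, u z a * lap z a ∂μ ≥ Λ z * (G z - δ * ((1 / 2) * (C + 1) * G z)) := by
      have : ∫ a, u z a * lap z a ∂μ ≤ -(G z) + δ * ((1 / 2) * (C + 1) * G z) := by
        have := mul_le_mul_of_nonneg_left h5 hδ
        simp only [hG] at this ⊢
        linarith
      nlinarith
    have h7 : G z - δ * ((1 / 2) * (C + 1) * G z) ≥ (1 / 2) * G z := by
      have := hGnn z
      nlinarith
    nlinarith [hGnn z]
  -- `q''` is continuous, hence `q'' ≥ 0` everywhere
  have hq''_cont : Continuous q'' := by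
    refine continuous_of_dominated (bound := fun _ => 2 * (M ^ 2 + M * M)) m_q''
      (fun z => Eventually.of_forall fun a => by rw [Real.norm_eq_abs]; exact b_q'' z a)
      (integrable_const _) (Eventually.of_forall fun a => ?_)
    have c1 : Continuous fun z => u z a := continuous_iff_continuousAt.2 fun z => (hd1 a z).continuousAt
    have c2 : Continuous fun z => uz z a := continuous_iff_continuousAt.2 fun z => (hd2 a z).continuousAt
    exact ((c2.pow 2).add (c1.mul (hczz a))).const_smul (2 : ℝ) |>.congr (fun z => by simp [smul_eq_mul])
  have hq''_nn : ∀ z, 0 ≤ q'' z := by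
    have hclosed : IsClosed {z | 0 ≤ q'' z} := isClosed_le continuous_const hq''_cont
    have hsub : Fᶜ ⊆ {z | 0 ≤ q'' z} := fun z hz =>
      (mul_nonneg (hΛ z) (hGnn z)).trans (hkey z hz)
    have : closure Fᶜ ⊆ {z | 0 ≤ q'' z} := hclosed.closure_subset_iff.2 hsub
    rw [hF.closure_eq] at this
    exact fun z => this (mem_univ z)
  -- `q' = deriv q` is monotone and `q` is bounded, so `q' ≡ 0`
  have hmono : Monotone (deriv q) := by
    rw [hderiv_q]
    exact monotone_of_deriv_nonneg hq'_diff fun z => by rw [hderiv_q']; exact hq''_nn z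
  have hq_bdd : ∀ z, |q z| ≤ M ^ 2 * (μ univ).toReal := by
    intro z
    rw [abs_of_nonneg (integral_nonneg fun a => sq_nonneg _)]
    calc q z = ∫ a, u z a ^ 2 ∂μ := rfl
      _ ≤ ∫ _, M ^ 2 ∂μ := integral_mono_of_nonneg (Eventually.of_forall fun a => sq_nonneg _)
          (integrable_const _) (Eventually.of_forall fun a => (le_abs_self _).trans (b_sq z a))
      _ = M ^ 2 * (μ univ).toReal := by rw [integral_const, smul_eq_mul, mul_comm]; rfl
  have hq'_zero : ∀ z, q' z = 0 := by
    intro z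
    have := deriv_eq_zero_of_monotone_deriv_of_abs_le hq_diff hmono hq_bdd z
    rwa [hderiv_q] at this
  -- hence `q'' ≡ 0` and `q` is constant
  have hq''_zero : ∀ z, q'' z = 0 := by
    intro z
    have h0 : HasDerivAt q' 0 z := by
      have : q' = fun _ => (0 : ℝ) := funext hq'_zero
      rw [this]; exact hasDerivAt_const z 0
    exact (hdq' z).unique h0
  have hq_const : ∀ z, q z = q z₁ := fun z =>
    is_const_of_deriv_eq_zero hq_diff (fun z => by rw [hderiv_q]; exact hq'_zero z) z z₁
  -- at `z₁`: `Λ z₁ * G z₁ ≤ 0`, so `G z₁ = 0`, so `q z₁ = 0`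
  have hG₁ : G z₁ = 0 := by
    have h := hkey z₁ hz₁
    rw [hq''_zero z₁] at h
    have : G z₁ ≤ 0 := by
      by_contra hcon
      have hpos : 0 < G z₁ := lt_of_not_ge hcon
      have := mul_pos hΛ₁ hpos
      linarith
    exact le_antisymm this (hGnn z₁)
  have hq₁ : q z₁ = 0 := by
    have h := hrev z₁
    have hnn : 0 ≤ q z₁ := integral_nonneg fun a => sq_nonneg _
    simp only [hG] at hG₁
    rw [hG₁, mul_zero] at h
    exact le_antisymm h hnn
  intro z
  have := hq_const z
  simp only [hq] at this hq₁
  rw [this, hq₁]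

end Core

end Summit.NavierStokesRegularity.NavierStokesRegularity.Theorems.PoloidalWindowDoorPoloidalWindowRigidityVerticalConvexity
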